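import Literature.AlgebraicGeometry.HodgeTheory.MiddleDimensionReductionProofs
import Literature.AlgebraicGeometry.HodgeTheory.HodgeTypePullback
import Literature.AlgebraicGeometry.HodgeTheory.SupportedHodgeClassesAlgebraic
import Literature.AlgebraicGeometry.HodgeTheory.ThomGysinClosedImmersion
import Literature.AlgebraicGeometry.HodgeTheory.GysinKernelProofs
import Literature.AlgebraicGeometry.HodgeTheory.GlobalInvariantCyclesProofs
import Literature.AlgebraicGeometry.HodgeTheory.SupportedClassesRationalProofs
import Literature.AlgebraicGeometry.Motives.ComplexPointsOrientation
import Literature.AlgebraicGeometry.Motives.AlgebraicEquivalenceFibreDimension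
import Literature.AlgebraicTopology.SingularHomology.GysinMapSupportProofs
import Literature.AlgebraicTopology.SingularHomology.CohomologyOfPoint
import Literature.Topology.FourManifolds.ComplexProjectiveSpaceOrientationProofs
import HarnessLib

/-!
# Reduction of the Hodge conjecture to the middle dimension, from Hodge models: BFNP Lemma 48 with the Gysin side constructed

Family `hodge`, layer `Literature/AlgebraicGeometry/HodgeTheory`. Companion of the named fact
`middleDimensionReduction` (file `MiddleDimensionReduction`; P. Brosnan, H. Fang, Z. Nie,
G. Pearlstein, *Singularities of admissible normal functions*, Invent. Math. 177 (2009), §6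
**Lemma 48**, arXiv:0711.0964 p. 13) and of `MiddleDimensionReductionProofs`, which formalises the
printed proof RELATIVE to a hypothetical Gysin formalism `(G : GysinFormalism)` with its Hodge
compatibility (`G.IsHodgeCompatible`: Gysin maps of bidegree `(r, r)`, a structure for which the
tree has no construction). This file removes that hypothesis structure entirely: the Gysin side of
the printed argument ("by the projection formula, `α ∪ pr_{1*}[Z] ≠ 0`") is run on the tree's
CONSTRUCTED Gysin morphisms `complexGysin μ` (`ComplexGysin`: `f_* = D_X⁻¹ f(ℂ)_* D_Y` through
Poincaré duality, which is the tree's theorem `OrientationFamily.hasPoincareDuality`; orientations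
of the closed manifolds `X(ℂ)` exist, `Motives.ComplexPoints.isOrientableOver`), whose
functoriality (`complexGysin_id`, `complexGysin_comp`), projection formula (`complexGysin_cup`),
compatibility with supports (`complexGysin_mem_supportedClasses`, from the PROVED support form
`gysinMap_restrictCompl_eq_zero_of_field ℂ` of Fulton, Young Tableaux App. B §B.2 Ex. 5) and
Thom–Gysin exactness for a smooth closed subvariety
(`exists_complexGysin_eq_of_isClosedImmersion`, Voisin II §6.1.1) are all theorems of the tree.
What remains hypothetical is Hodge-theoretic only, and consists of the two named facts
`nonempty_hodgeModel` (Hodge models of the auxiliary varieties `X × ℙʳ`: Serre GAGA §2, de Rham,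
the Hodge decomposition) and `hodgePQ_independent_of_hodgeModel` (all Hodge models cut out the
same `H^{p,q}`), through which `preservesHodgeType_of_nonempty_hodgeModel` (file
`HodgeTypePullback`, Voisin I §7.3.2: `f^*` is a morphism of Hodge structures) feeds the
pull-backs, and the compatibility of the cup product with Hodge types (`CupPreservesHodgeType`,
Voisin I Thm. 5.29 with §7.1.2: wedge products of forms of types `(p,q)`, `(p',q')` have type
`(p+p', q+q')`, and the de Rham comparison is multiplicative), taken as a hypothesis on the
auxiliary varieties.

## The printed proof and its two halves here

Printed (arXiv p. 13), for `α ∈ Hdg^k Y` perpendicular to `Alg^{dim Y − k} Y` under the perfect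
pairing `Hdg^k ⊗ Hdg^{dim Y−k} → ℚ`: "Suppose then that `dim Y < 2k`. In this case, set
`X = Y × ℙ^{2k − dim Y}` and let `β = pr₁^* α`. Suppose `β ∪ [Z] ≠ 0` for some `[Z] ∈ Alg^k X`.
Then, by the projection formula, `α ∪ pr_{1*}[Z] ≠ 0`. […] Finally, suppose that `dim Y > 2k`.
Since `Y` is projective, we can use Bertini […] By weak Lefschetz […]".

* **Degrees `2p < n` (the product half), pairing-free, on `complexGysin`.** For `X` smooth
  projective of dimension `n = 2p + r`, `r ≥ 1`, `P = ℙʳ`, `V = X × P` (smooth projective of the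
  even dimension `n + r = 2(p + r)`), a complex point `t ∈ P(ℂ)` with slice
  `s = (𝟙, t) : X ⟶ V`, and a rational `(p, p)`-class `c ∈ H²ᵖ(X(ℂ); ℂ)`:
  pick a rational class `ρ ≠ 0` in the top degree `H^{2r}(P(ℂ); ℂ) ≅ ℂ` (rational classes span,
  `span_isRationalClass_eq_top_of_isSmoothProjective_holds`; `b_{2r} = b_0 = 1`); every top-degree
  class of `P` is of Hodge type `(r, r)` (`isOfHodgeType_of_degree_eq_two_mul`: a real `2r`-form
  on an `r`-dimensional complex vector space is invariant under the unit circle, the real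
  determinant of `e^{iθ}` being `|e^{irθ}|² = 1`), so `c' = pr₁^* c ∪ pr₂^* ρ` is a rational class
  of type `(p + r, p + r)` in the middle degree of `V` (pull-backs preserve Hodge types;
  `CupPreservesHodgeType`), hence ALGEBRAIC by the middle-dimensional hypothesis, and
  `pr_{1*} c' ∈ Nᵖ H²ᵖ(X(ℂ); ℂ)` (`pr_{1*}` lowers the coniveau by `r`). Finally
  `pr_{1*} c' = c ∪ pr_{1*} pr₂^* ρ = λ c` with `λ ≠ 0`: `ρ` dies off the point `t`
  (`restrictCompl_pt_eq_zero`), so `pr₂^* ρ` dies off the fibre `pr₂⁻¹(t) = s(X)`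
  (`range_sliceAt_left_base`), hence `pr₂^* ρ = s_* y` for some `y ∈ H⁰(X(ℂ); ℂ) = ℂ · 1`
  (Thom–Gysin exactness for the closed immersion `s`; `X(ℂ)` is path connected), i.e.
  `pr₂^* ρ = λ · s_* 1` and `pr_{1*} pr₂^* ρ = λ · (s ≫ pr₁)_* 1 = λ · 1`; and `λ ≠ 0` because
  `pr₂^*` is injective (`pr₂` has the section `(x₀, 𝟙)`) and `ρ ≠ 0`. So `c = λ⁻¹ pr_{1*} c'` is
  algebraic (`mem_algebraicClasses_of_two_mul_add_eq_of_cupPreservesHodgeType`).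
* **Degrees `2p ≥ n`.** The pull-back-only road of `MiddleDimensionReductionProofs`
  (`mem_algebraicClasses_of_le_two_mul_of_preservesHodgeType`: `c = s_t^* pr₁^* c` on `X × ℙ¹` for
  a general slice), whose only input `PreservesHodgeType (n + 1) n pr₁` is now
  `preservesHodgeType_of_nonempty_hodgeModel`.

Result: `middleDimensionReduction_of_nonempty_hodgeModel` — the named fact from
`nonempty_hodgeModel` (all smooth projective `X`), `hodgePQ_independent_of_hodgeModel` and
`CupPreservesHodgeType` (all smooth projective `X`). No named fact is introduced and the named
fact itself is untouched (its discharge `middleDimensionReduction_holds` is this theorem fed with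
the discharges of those three inputs).

## References

* [BrosnanFangNiePearlstein2009] P. Brosnan, H. Fang, Z. Nie, G. Pearlstein, Singularities of
  admissible normal functions, Invent. Math. 177 (2009), §6 Lemma 48 (arXiv:0711.0964, p. 13).
* [VoisinHodgeI2002] C. Voisin, Hodge Theory and Complex Algebraic Geometry I, §2.3.1, Thm. 5.29,
  §7.1.2, §7.3.2, §11.1.2.
* [VoisinHodgeII2003] C. Voisin, Hodge Theory and Complex Algebraic Geometry II, §6.1.1.
* [FultonYoungTableaux1997] W. Fulton, Young Tableaux, App. B §B.1 (5)–(6), §B.2 Exercise 5.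
* [KerrPearlstein2011] M. Kerr, G. Pearlstein, An exponential history of functions with
  logarithmic growth, MSRI Publ. 58 (2011), §3.1.
-/

noncomputable section

open scoped Manifold ContDiff
open CategoryTheory CategoryTheory.Limits AlgebraicGeometry MonoidalCategory CartesianMonoidalCategory
open Literature.AlgebraicTopology.SingularHomology
open Literature.NumberTheory.Transcendental (complexDeRhamCohomology hodgePQ IsOfType
  cclosedSmoothForms tangentRotate)

namespace Literature.AlgebraicGeometry.HodgeTheory

section HodgeTheory

/-! ### Top-degree classes are of Hodge type `(n, n)` -/

/-- A real-alternating `ℂ`-valued form of top degree `2n` on a complex vector space `E` of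
dimension `n` is invariant under a complex scalar of modulus one: `φ(z v₁, …, z v₂ₙ) = det_ℝ(z) φ(v)`
and `det_ℝ(z · 𝟙_E) = |zⁿ|² = 1`. [cite: VoisinHodgeI2002, §2.3.1] -/
theorem ContinuousAlternatingMap.apply_smul_eq_of_finrank_eq {E : Type*} [NormedAddCommGroup E]
    [NormedSpace ℂ E] [FiniteDimensional ℂ E] {n : ℕ} (hn : Module.finrank ℂ E = n)
    (φ : E [⋀^Fin (2 * n)]→L[ℝ] ℂ) {z : ℂ} (hz : Complex.normSq z = 1) (v : Fin (2 * n) → E) :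
    φ (fun i ↦ z • v i) = φ v := by
  -- a real basis with `2n` elements
  have hE : Module.finrank ℝ E = 2 * n := by
    rw [← hn, ← Module.finrank_mul_finrank ℝ ℂ E, Complex.finrank_real_complex]
  let b : Module.Basis (Fin (2 * n)) ℝ E := Module.finBasisOfFinrankEq ℝ E hE
  -- multiplication by `z`, of real determinant `|zⁿ|² = 1`
  let J : E →ₗ[ℝ] E := (z • LinearMap.id : E →ₗ[ℂ] E).restrictScalars ℝ
  have hJ : LinearMap.det J = 1 := by
    change LinearMap.det ((z • LinearMap.id : E →ₗ[ℂ] E).restrictScalars ℝ) = 1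
    rw [Literature.Topology.FourManifolds.det_restrictScalars_eq_normSq, LinearMap.det_smul,
      LinearMap.det_id, mul_one, map_pow, hz, one_pow]
  have hv : (fun i ↦ z • v i) = J ∘ v := rfl
  -- test against the real-linear functionals `re`, `im`
  have key : ∀ ℓ : ℂ →ₗ[ℝ] ℝ, ℓ (φ (fun i ↦ z • v i)) = ℓ (φ v) := by
    intro ℓ
    let g : E [⋀^Fin (2 * n)]→ₗ[ℝ] ℝ := ℓ.compAlternatingMap φ.toAlternatingMap
    have hg : ∀ w, g w = ℓ (φ w) := fun w ↦ rfl
    rw [← hg, ← hg, g.eq_smul_basis_det b, AlternatingMap.smul_apply, AlternatingMap.smul_apply,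
      hv, b.det_comp, hJ, one_mul]
  apply Complex.ext
  · exact key Complex.reLm
  · exact key Complex.imLm

/-- **Every `2n`-form on an `n`-dimensional complex manifold is of type `(n, n)`**
(`Ω^{2n}_{X,ℂ} = Ω^{n,n}`: the weight of the unit circle on top-degree real forms is
`det_ℝ(e^{iθ}) = 1`). [cite: VoisinHodgeI2002, §2.3.1] -/
theorem isOfType_of_degree_eq_two_mul_finrank {E : Type*} [NormedAddCommGroup E] [NormedSpace ℂ E]
    [FiniteDimensional ℂ E] {M : Type*} [TopologicalSpace M] [ChartedSpace E M] {n : ℕ}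
    (hn : Module.finrank ℂ E = n) (α : Literature.Geometry.Kaehler.MForm 𝓘(ℝ, E) M ℂ (2 * n)) :
    IsOfType n n α := by
  refine ⟨(two_mul n).symm, fun x θ v ↦ ?_⟩
  have h1 : Complex.exp ((((n : ℤ) - n : ℤ) : ℂ) * θ * Complex.I) = 1 := by
    rw [sub_self, Int.cast_zero, zero_mul, zero_mul, Complex.exp_zero]
  rw [h1, one_mul]
  have hz : Complex.normSq (Complex.exp (θ * Complex.I)) = 1 := by
    rw [Complex.normSq_eq_norm_sq, Complex.norm_exp_ofReal_mul_I, one_pow]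
  exact ContinuousAlternatingMap.apply_smul_eq_of_finrank_eq hn (α x) hz v

/-- Hence `H^{n,n}_dR = H^{2n}_dR` on an `n`-dimensional complex manifold (every class is the class
of a closed `2n`-form, which is of type `(n, n)`). [cite: VoisinHodgeI2002, §2.3.1 and §6.1] -/
theorem hodgePQ_two_mul_finrank_eq_top {E : Type*} [NormedAddCommGroup E] [NormedSpace ℂ E]
    [FiniteDimensional ℂ E] {M : Type*} [TopologicalSpace M] [ChartedSpace E M] {n : ℕ}
    (hn : Module.finrank ℂ E = n) : hodgePQ E M (2 * n) n n = ⊤ := by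
  refine eq_top_iff.mpr fun u _ ↦ ?_
  obtain ⟨β, rfl⟩ := complexDeRhamCohomology.mk_surjective (E := E) (M := M) (k := 2 * n) u
  exact Submodule.subset_span ⟨β, isOfType_of_degree_eq_two_mul_finrank hn _, rfl⟩

variable {n : ℕ} {X : Motives.SchemeOver ℂ}

/-- **Every class of top degree `H²ⁿ(X(ℂ); ℂ)` is of Hodge type `(n, n)`** as soon as `X`
(of dimension `n`) has a Hodge model: the model space has complex dimension `n`
(`IsAnalytification.finrank_eq`) and `H^{n,n}_dR(X^an) = H^{2n}_dR(X^an)`. (With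
`mem_algebraicClasses_of_degree_top`: the degree `2 dim X` of the Hodge conjecture.)
[cite: VoisinHodgeI2002, §2.3.1 and §11.1.2] -/
theorem isOfHodgeType_of_degree_eq_two_mul (A : HodgeModel n X) (c : complexBetti X (2 * n)) :
    IsOfHodgeType n X (2 * n) n n c := by
  refine ⟨A, ?_⟩
  change A.pullback (2 * n) c ∈
    (hodgePQ A.model A.carrier (2 * n) n n).map (A.deRham A.carrier (2 * n)).toLinearMap
  rw [hodgePQ_two_mul_finrank_eq_top A.isAnalytification.finrank_eq, Submodule.map_top,
    LinearEquiv.range]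
  trivial

/-! ### A non-zero rational class of top degree -/

/-- For `X` smooth projective of dimension `n`, `H²ⁿ(X(ℂ); ℂ)` contains a non-zero RATIONAL class:
`dim H²ⁿ = dim H⁰ = 1` (Poincaré duality, `X(ℂ)` path connected) and the rational classes span
`H²ⁿ(X(ℂ); ℂ)` (`span_isRationalClass_eq_top_of_isSmoothProjective_holds`).
[cite: HatcherAT2002, §3.3 Cor. 3.37 and §3.1 Thm. 3.2] [cite: VoisinHodgeI2002, §7.1.1] -/
theorem exists_isRationalClass_ne_zero_of_degree_eq_two_mul (hX : Motives.IsSmoothProjective n X) :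
    ∃ ρ : complexBetti X (2 * n), IsRationalClass ρ ∧ ρ ≠ 0 := by
  haveI := pathConnectedSpace_complexPoints hX
  have h1 : Module.finrank ℂ (complexBetti X (2 * n)) = 1 := by
    change Module.finrank ℂ (singularCohomology ℂ ℂ (Motives.ComplexPoints X) (2 * n)) = 1
    rw [Motives.ComplexPoints.finrank_singularCohomology_eq_of_add_eq ℂ hX
      (show 2 * n + 0 = 2 * n by omega),
      (singularCohomologyZeroEquiv ℂ ℂ (Motives.ComplexPoints X)).finrank_eq, Module.finrank_self]
  by_contra h
  have h' : ∀ c : complexBetti X (2 * n), IsRationalClass c → c = 0 :=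
    fun c hc ↦ by_contra fun hne ↦ h ⟨c, hc, hne⟩
  have hbot : Submodule.span ℂ {c : complexBetti X (2 * n) | IsRationalClass c} = ⊥ :=
    Submodule.span_eq_bot.2 fun c hc ↦ h' c hc
  have htop := span_isRationalClass_eq_top_of_isSmoothProjective_holds n X hX (2 * n)
  rw [hbot] at htop
  haveI : Nontrivial (complexBetti X (2 * n)) := Module.nontrivial_of_finrank_eq_succ h1
  exact bot_ne_top htop

/-! ### The fibre of `pr₂ : X × T → T` over a rational point is the slice -/

/-- **The fibre of `pr₂` over `t` is the slice `s_t(X) = X × {t}`**: for a rational point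
`t ∈ T(ℂ)`, the underlying set of `pr₂⁻¹(t)` in `X ×_ℂ T` is the image of the slice
`s_t = (𝟙, t) : X ⟶ X × T` (the slice square is cartesian, `Motives.isPullback_sliceAt`, and the
image of a base change is the preimage of the image, `Scheme.Pullback.range_fst`).
[cite: Fulton1998, §10.1] -/
theorem range_sliceAt_left_base (X : Motives.SchemeOver ℂ) {T : Motives.SchemeOver ℂ}
    (t : Motives.ComplexPoints T) :
    Set.range (Motives.sliceAt X t).left.base = (snd X T).left.base ⁻¹' {t.pt} := by
  have h := Motives.isPullback_sliceAt (X := X) t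
  have hrange : Set.range t.toSpecHom.base = {t.pt} := by
    ext y
    constructor
    · rintro ⟨q, rfl⟩
      rw [Set.mem_singleton_iff,
        show q = IsLocalRing.closedPoint ℂ from Subsingleton.elim (α := ↥(Spec (CommRingCat.of ℂ))) _ _]
      rfl
    · intro hy
      rw [Set.mem_singleton_iff.1 hy]
      exact ⟨IsLocalRing.closedPoint ℂ, rfl⟩
  rw [← hrange, ← Scheme.Pullback.range_fst (snd X T).left t.toSpecHom, ← h.isoPullback_hom_fst]
  change Set.range ((pullback.fst (snd X T).left t.toSpecHom).base ∘ h.isoPullback.hom.base) = _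
  rw [Set.range_comp, Set.range_eq_univ.mpr h.isoPullback.hom.surjective, Set.image_univ]

/-! ### The product half on the constructed Gysin morphisms -/

/-- **The product half of BFNP Lemma 48 (degrees `2p < n`), on the constructed Gysin morphisms,
from Hodge models and the Hodge compatibility of cup products.** Let `X` be smooth projective
of dimension `n = 2p + r`, `r ≥ 1`, and `c ∈ H²ᵖ(X(ℂ); ℂ)` a rational `(p, p)`-class; suppose every
rational middle-degree Hodge class on every even-dimensional smooth projective complex variety
is algebraic. With `P = ℙʳ`, `V = X × P` and a rational class `ρ ≠ 0` of `H^{2r}(P(ℂ); ℂ)` (of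
type `(r, r)`), the class `c' = pr₁^* c ∪ pr₂^* ρ` is a rational `(p + r, p + r)`-class in the
middle degree of the `2(p + r)`-fold `V`, hence algebraic, and
`c = λ⁻¹ pr_{1*} c' ∈ pr_{1*} N^{p+r} H^{2(p+r)}(V(ℂ)) ⊆ Nᵖ H²ᵖ(X(ℂ))`, where
`pr_{1*} pr₂^* ρ = λ · 1` with `λ ≠ 0` (`pr₂^* ρ` dies off the fibre `pr₂⁻¹(t) = s_t(X)`, so it is
`s_{t*}` of a degree-`0` class `λ · 1` by Thom–Gysin exactness, `(s_t ≫ pr₁)_* 1 = 1`, and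
`pr₂^*` is injective). The Gysin morphisms are the tree's `complexGysin μ` for an(y) orientation
family `μ`; Poincaré duality, functoriality, the projection formula and the compatibility with
supports are theorems of the tree. In print: "set `X = Y × ℙ^{2k − dim Y}` and let `β = pr₁^* α`
[…] by the projection formula, `α ∪ pr_{1*}[Z] ≠ 0`" (the case `dim Y < 2k`, read without the
pairing). [cite: BrosnanFangNiePearlstein2009, §6 Lemma 48 (proof, case dim Y < 2k)]
[cite: VoisinHodgeI2002, §7.3.2 and §11.1.2] [cite: FultonYoungTableaux1997, Appendix B §B.1 (5)–(6)] -/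
theorem mem_algebraicClasses_of_two_mul_add_eq_of_cupPreservesHodgeType
    (hI : hodgePQ_independent_of_hodgeModel)
    (hA : ∀ ⦃n : ℕ⦄ ⦃X : Motives.SchemeOver ℂ⦄, nonempty_hodgeModel n X)
    (hcup : ∀ ⦃n : ℕ⦄ ⦃X : Motives.SchemeOver ℂ⦄, Motives.IsSmoothProjective n X →
      CupPreservesHodgeType n X)
    (hmid : ∀ ⦃m : ℕ⦄ ⦃Y : Motives.SchemeOver ℂ⦄, Motives.IsSmoothProjective (2 * m) Y →
      ∀ c : complexBetti Y (2 * m), IsRationalClass c → IsOfHodgeType (2 * m) Y (2 * m) m m c →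
        c ∈ algebraicClasses Y m)
    {n : ℕ} {X : Motives.SchemeOver ℂ} (hX : Motives.IsSmoothProjective n X) {p r : ℕ}
    (hr : 2 * p + r = n) (hr1 : 1 ≤ r) (c : complexBetti X (2 * p)) (hc : IsRationalClass c)
    (hpp : IsOfHodgeType n X (2 * p) p p c) : c ∈ algebraicClasses X p := by
  -- an orientation family (orientations of the closed manifolds `Y(ℂ)` exist) and its duality
  let μ : OrientationFamily := fun n Y hY ↦ (Motives.ComplexPoints.isOrientableOver ℂ hY).some
  have hμ : μ.HasPoincareDuality := OrientationFamily.hasPoincareDuality μ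
  have hS := gysinMap_restrictCompl_eq_zero_of_field.{0, 0} ℂ
  -- the auxiliary factor `P = ℙʳ`, a complex point `t`, the even-dimensional `V = X × P`
  set P := Motives.projectiveSpace r ℂ with hPdef
  have hP : Motives.IsSmoothProjective r P := Motives.isSmoothProjective_projectiveSpace_holds ℂ r
  haveI := connectedSpace_complexPoints hP
  obtain ⟨t⟩ : Nonempty (Motives.ComplexPoints P) := inferInstance
  haveI := connectedSpace_complexPoints hX
  obtain ⟨x₀⟩ : Nonempty (Motives.ComplexPoints X) := inferInstance
  have hV : Motives.IsSmoothProjective (n + r) (X ⊗ P) := Motives.IsSmoothProjective.tensor_holds hX hP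
  haveI : LocallyOfFiniteType P.hom := locallyOfFiniteType_of_isSmoothProjective hP
  haveI : IsClosedImmersion (Motives.sliceAt X t).left := Motives.isClosedImmersion_sliceAt_left t
  haveI := pathConnectedSpace_complexPoints hX
  -- a non-zero rational top-degree class `ρ` on `P`, of type `(r, r)`
  obtain ⟨ρ, hρ, hρ0⟩ := exists_isRationalClass_ne_zero_of_degree_eq_two_mul hP
  obtain ⟨B⟩ := (hA (n := r) (X := P)).nonempty hP
  have hρtyp : IsOfHodgeType r P (2 * r) r r ρ := isOfHodgeType_of_degree_eq_two_mul B ρ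
  -- `pr₂^* ρ` dies off the slice `s_t(X) = pr₂⁻¹(t)` …
  have hρsupp : complexBetti.restrictCompl (X ⊗ P) (Set.range (Motives.sliceAt X t).left.base)
      (2 * r) (complexBetti.map (snd X P) (2 * r) ρ) = 0 := by
    rw [range_sliceAt_left_base]
    exact complexBetti.restrictCompl_map_eq_zero (snd X P) (restrictCompl_pt_eq_zero hP hr1 t ρ)
  -- … hence is a Gysin image `s_{t*} y`, `y ∈ H⁰(X(ℂ); ℂ) = ℂ · 1`: `pr₂^* ρ = λ · s_{t*} 1`
  obtain ⟨y, hy⟩ := exists_complexGysin_eq_of_isClosedImmersion μ hV hX (Motives.sliceAt X t)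
    (show 0 + 2 * (n + r) = 2 * r + 2 * n by ring) hρsupp
  obtain ⟨lam, rfl⟩ := singularCohomology.exists_eq_smul_one y
  rw [map_smul] at hy
  -- `λ ≠ 0`: `pr₂^*` is injective (`pr₂` has the section `(x₀, 𝟙)`) and `ρ ≠ 0`
  have hlam : lam ≠ 0 := by
    rintro rfl
    rw [zero_smul] at hy
    apply hρ0
    let j : P ⟶ X ⊗ P := CartesianMonoidalCategory.lift (Motives.toSpecOver P ≫ x₀) (𝟙 P)
    have hj : j ≫ snd X P = 𝟙 P := CartesianMonoidalCategory.lift_snd _ _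
    have hρj : complexBetti.map j (2 * r) (complexBetti.map (snd X P) (2 * r) ρ) = ρ := by
      rw [← CategoryTheory.comp_apply, ← complexBetti.map_comp, hj, complexBetti.map_id,
        CategoryTheory.id_apply]
    rw [← hρj, ← hy, map_zero]
  -- the middle-degree class `c' = pr₁^* c ∪ pr₂^* ρ` on `V`: rational, of type `(p + r, p + r)`
  set c' : complexBetti (X ⊗ P) (2 * (p + r)) :=
    cupProduct (show 2 * p + 2 * r = 2 * (p + r) by ring) (complexBetti.map (fst X P) (2 * p) c)
      (complexBetti.map (snd X P) (2 * r) ρ) with hc'def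
  have hc'rat : IsRationalClass c' := (hc.map _).cup _ (hρ.map _)
  have hc'typ : IsOfHodgeType (n + r) (X ⊗ P) (2 * (p + r)) (p + r) (p + r) c' :=
    hcup hV _ (preservesHodgeType_of_nonempty_hodgeModel hI (hA (X := X ⊗ P)) hV hX (fst X P) hpp)
      (preservesHodgeType_of_nonempty_hodgeModel hI (hA (X := X ⊗ P)) hV hP (snd X P) hρtyp)
  -- `V` has the even dimension `n + r = 2(p + r)`: `c'` is algebraic by hypothesis
  have hdim : n + r = 2 * (p + r) := by omega
  have hV' : Motives.IsSmoothProjective (2 * (p + r)) (X ⊗ P) := hdim ▸ hV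
  rw [hdim] at hc'typ
  have halg : c' ∈ algebraicClasses (X ⊗ P) (p + r) := hmid hV' c' hc'rat hc'typ
  -- `pr_{1*} c' ∈ Nᵖ H²ᵖ(X(ℂ); ℂ)` (Gysin maps and supports)
  have hpush : complexGysin μ hV hX (fst X P) (show 2 * (p + r) + 2 * n = 2 * p + 2 * (n + r) by ring)
      c' ∈ algebraicClasses X p :=
    complexGysin_mem_supportedClasses hS μ hμ hV hX (fst X P) _ (by omega) halg
  -- `pr_{1*} c' = c ∪ pr_{1*} pr₂^* ρ = c ∪ λ · (s_t ≫ pr₁)_* 1 = λ c`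
  have hone : complexGysin μ hV hX (fst X P) (show 2 * r + 2 * n = 0 + 2 * (n + r) by ring)
      (complexBetti.map (snd X P) (2 * r) ρ) = lam • singularCohomology.one ℂ (Motives.ComplexPoints X) := by
    rw [← hy, map_smul, ← LinearMap.comp_apply,
      ← complexGysin_comp hμ hX hV hX (Motives.sliceAt X t) (fst X P)]
    simp only [Motives.sliceAt_fst]
    rw [complexGysin_id hμ hX 0, LinearMap.id_apply]
  have hcc : complexGysin μ hV hX (fst X P) (show 2 * (p + r) + 2 * n = 2 * p + 2 * (n + r) by ring)
      c' = lam • c := by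
    rw [hc'def, complexGysin_cup hμ hV hX (fst X P) _ _
      (show 2 * r + 2 * n = 0 + 2 * (n + r) by ring) (Nat.add_zero (2 * p)), hone,
      LinearMap.map_smul, cupProduct_one]
  rw [hcc] at hpush
  have h := Submodule.smul_mem _ lam⁻¹ hpush
  rwa [smul_smul, inv_mul_cancel₀ hlam, one_smul] at h

/-- **BFNP Lemma 48 from Hodge models: the reduction of the Hodge conjecture to middle-dimensional
classes on even-dimensional varieties, with the Gysin side constructed.** Granted the named facts
`nonempty_hodgeModel` (every smooth projective complex variety has a Hodge model: Serre GAGA §2,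
de Rham, the Hodge decomposition) and `hodgePQ_independent_of_hodgeModel` (all Hodge models cut
out the same `H^{p,q}`), and the Hodge compatibility of cup products on smooth projective
varieties (`CupPreservesHodgeType`, Voisin I Thm. 5.29 / §7.1.2), the named fact
`middleDimensionReduction` holds: if every rational middle-degree Hodge class on every
even-dimensional smooth projective complex variety is algebraic, then every rational
`(p, p)`-class on every smooth projective `X` of any dimension `n` is algebraic — for `2p < n` by
the product half on `X × ℙ^{n−2p}` (`mem_algebraicClasses_of_two_mul_add_eq_of_cupPreservesHodgeType`,
Gysin morphisms `complexGysin`), for `2p ≥ n` by general slices of `X × (ℙ¹)^{2p−n}`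
(`mem_algebraicClasses_of_le_two_mul_of_preservesHodgeType`, pull-backs only), the Hodge
compatibility of pull-backs being `preservesHodgeType_of_nonempty_hodgeModel` (Voisin I §7.3.2).
Compared with print, Bertini, weak Lefschetz and the perfect pairing on `Hdg` are not needed;
compared with `middleDimensionReduction_of_gysinFormalism_of_preservesHodgeType`, no hypothetical
Gysin formalism is needed. [cite: BrosnanFangNiePearlstein2009, §6 Lemma 48]
[cite: KerrPearlstein2011, §3.1] [cite: VoisinHodgeI2002, §7.3.2] -/
theorem middleDimensionReduction_of_nonempty_hodgeModel
    (hA : ∀ ⦃n : ℕ⦄ ⦃X : Motives.SchemeOver ℂ⦄, nonempty_hodgeModel n X)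
    (hI : hodgePQ_independent_of_hodgeModel)
    (hcup : ∀ ⦃n : ℕ⦄ ⦃X : Motives.SchemeOver ℂ⦄, Motives.IsSmoothProjective n X →
      CupPreservesHodgeType n X) :
    middleDimensionReduction := by
  intro hmid n X hX p c hc hpp
  rcases Nat.lt_or_ge n (2 * p) with hlt | hle
  · -- above the middle: general slices of `X × (ℙ¹)^{2p-n}`, pull-backs preserve Hodge types
    exact mem_algebraicClasses_of_le_two_mul_of_preservesHodgeType
      (fun n X hX ↦ preservesHodgeType_of_nonempty_hodgeModel hI
        (hA (X := X ⊗ Motives.projectiveSpace 1 ℂ))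
        (Motives.IsSmoothProjective.tensor_holds hX (Motives.isSmoothProjective_projectiveSpace_holds ℂ 1))
        hX (fst X (Motives.projectiveSpace 1 ℂ)))
      hmid hX hlt.le c hc hpp
  · rcases Nat.eq_or_lt_of_le hle with heq | hlt'
    · -- the middle degree itself: "then we are already done"
      subst heq
      exact hmid hX c hc hpp
    · -- below the middle: the product half with `r = n - 2p ≥ 1`
      exact mem_algebraicClasses_of_two_mul_add_eq_of_cupPreservesHodgeType hI hA hcup hmid hX
        (r := n - 2 * p) (by omega) (by omega) c hc hpp

end HodgeTheory

end Literature.AlgebraicGeometry.HodgeTheory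

end
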